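import Summits.QuantumFields.YangMills.Theorems.BalabanUVNodesN16RankNWilsonWeightDetPhase
import HarnessLib

/-!
# YM-DAG node N16 (NE3), the re-keyed N07 in-edge — DET-TRANSPORT: the determinant commutes with parallel transport (9), the block average (42) and its iterate (43) in the
# small-field regime, and carries the (8)-class ∕ admissibility of a `U(n)`-valued configuration to its RANK-ONE determinant configuration (file B of the g7 piece)

Cell `pub-ymgap`, width seat `pub-ymgap-dag-n16-w2` (director-ym №197 ∕ HUMAN RULING D-0149), generation 7.  `--kind proof --supports stmt-QuantumFields-27366 --as helper`
(K3⁸, KEY MAP v2).  `bears_on: R4∕N16`, edge N07 → N16.  COUNT-NEUTRAL.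

HONEST FRAMING.  Kernel bookkeeping over file A (`…N16RankNWilsonWeightDetPhase`: `det W = e^{tr log W}`, `log(e^{iτ}·1) = iτ·1`) and the tree's (9)∕(42)∕(43) (`B7Prop1Explicit`,
`B7Prop2Explicit`): `det` is multiplicative, `det e^X = e^{tr X}` (Liouville), and on the guard `n·|V(Γ_{c,x})V(c)⁻¹ − 1| ≤ 1∕3` the scalar `log` of `det` is `tr log`.  Nothing of Bałaban is
asserted or refuted; DischargeTest `stub_reg910Slot` NOT closed; no K3⁸ v6 stub named or closed; N16 ∕ N07 NOT discharged; counts UNMOVED (typed 28∕28 · discharged 5∕27 · A 5∕28).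
R4 closes the conditional finite-𝕋⁴ rung `BalabanLadder.UV` only; NOT ℝ⁴ ∕ OS ∕ mass gap; the YM mass gap (Clay) is NOT proved by any of this.

WHAT IS PROVED ([folklore], 0 `sorry`, 0 `def`).  `U` is an `M_n(ℂ)ˣ`-valued configuration on `ℤ^d`; its DETERMINANT CONFIGURATION is ANY `M_m(ℂ)ˣ`-valued `u` (`m` non-empty; rank
one in the application) with `u(x,κ) = det U(x,κ)·1` — the relation `hdet`, no definition (§1 `exists_det_cfg` supplies one).  §1 `hol_det` (`u(Γ) = det U(Γ)·1` for every word),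
`Wcx_det`, `isUnitaryCfg_det`, `isPeriodicCfg_det`, ★ `smallField_det` (`SmallField U a`, `a ≤ 1∕3` ⟹ `SmallField u (2·n·a)` — file A's `|det W − 1| ≤ 2n|W − 1|`), `det_scalarCfg_imag`
(the determinant configuration of `e^{iG}·1_n` is `e^{i·n·G}·1`).  §2 on the guard `∀ r, n·|U(Γ_{c,x_r})U(c)⁻¹ − 1| ≤ 1∕3`: `mlog_Wcx_det` (`log(det W·1) = (tr log W)·1`), `Xavg_det`
(`X_c(u) = (tr X_c(U))·1`), ★★ `bavg_det` (**`ū_c = det(Ū_c)·1`** — (42) commutes with `det`), `rescale_det`, `wcx_guard_of_smallField` (the guard from `SmallField` via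
`B7Prop2Explicit.norm_Wcx_sub_one_le`), ★★ `avgIter_det` (**`avgIter L u j = det(avgIter L U j)·1`** for `j ≤ k` in leaf-05's regime RANK-SCALED: `1024·n·(d+1)(d+4)L²ε ≤ 1`).
§3 `sfClass_det` (`U ∈ sfClass d L N ε k ⟹ u ∈ sfClass d L N (2nε) k`), ★★ `admissible_det` (admissible for the datum `e^{iG}·1_n` over `sfClass ε` ⟹ the determinant configuration is
admissible for the datum `e^{inG}·1` over `sfClass (2nε)`).

DEPENDENCES (by name): file A (`det_eq_cexp_tau`, `trace_mlog_eq_tau_mul_I`, `abs_tau_le`, `norm_det_sub_one_le`); `B7Prop1Explicit` (`hol`, `Wcx`, `Xavg`, `bavg`, `Wcx_eq_hol_loop`,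
`expUnit`); `B7Prop2Explicit` (`rescale`, `avgIter`, `norm_Wcx_sub_one_le`, `hol_mem_of`, `unitaryUnits`); `AveragingDeficitTransport.mem_U1_of_unitary`; `MinimalActionCompact`
(`avgIter_unitary_smallField_two`); `MinimalActionRate` (`sfClass`); `MinimalActionSandwich` (`admissible`); `T4AveragingDeficitWallBoundary` (`scalarCfg`, `mlog_exp_smul_one`,
`smul_one_mem_unitary`); `FederbushMean` (`cexp_smul_one`, `norm_smul_one_sub_one`, `norm_smul_one_eq`); `Literature.Analysis.Matrix.det_exp_eq_exp_trace`; Mathlib (`Units.coe_map`,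
`Matrix.detMonoidHom`, `Matrix.det_conjTranspose`, `Complex.coe_smul`, `Matrix.trace_smul`, `Matrix.trace_sum`).
-/

open scoped BigOperators Matrix Matrix.Norms.L2Operator
open NormedSpace Finset

namespace Summit.QuantumFields.YangMills.BalabanUVNodes.N16DetTransport

open Literature.MathematicalPhysics.QuantumFieldTheory.Balaban1983to89
open B7Prop1Explicit B7Prop2Explicit MatrixLog UnitaryModel
open T4AveragingDeficitWall hiding Site Plane Plaq Bond
open T4AveragingDeficitWallBoundary (scalarCfg mlog_exp_smul_one smul_one_mem_unitary IsPeriodicCfg)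
open FederbushMean (cexp_smul_one norm_smul_one_sub_one norm_smul_one_eq)
open Literature.Analysis.Matrix (det_exp_eq_exp_trace)
open Summit.QuantumFields.BalabanUV.T4Continuum
open AveragingDeficitTransport (mem_U1_of_unitary)
open MinimalActionCompact (avgIter_unitary_smallField_two)
open MinimalActionSandwich (admissible)
open MinimalActionRate (sfClass)
open Summit.QuantumFields.YangMills.BalabanUVNodes.N16RankNWilsonWeightDetPhase (det_eq_cexp_tau trace_mlog_eq_tau_mul_I abs_tau_le norm_det_sub_one_le)

noncomputable section

variable {d : ℕ} {n : Type} [Fintype n] [DecidableEq n] {m : Type} [Fintype m] [DecidableEq m]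

/-! ## §1 The determinant configuration: transport, unitarity, periodicity, small field -/

/-- **A determinant configuration exists**: `u(x,κ) := det U(x,κ)·1` is a unit of `M_m(ℂ)` (the unit `det U(x,κ)` pushed along `ℂ → M_m(ℂ)`). [folklore] -/
theorem exists_det_cfg (U : B7Prop1Explicit.Site d → Fin d → (Matrix n n ℂ)ˣ) :
    ∃ u : B7Prop1Explicit.Site d → Fin d → (Matrix m m ℂ)ˣ, ∀ x κ, (u x κ : Matrix m m ℂ) = (U x κ : Matrix n n ℂ).det • (1 : Matrix m m ℂ) := by
  refine ⟨fun x κ => Units.map (((algebraMap ℂ (Matrix m m ℂ)).toMonoidHom).comp Matrix.detMonoidHom) (U x κ), fun x κ => ?_⟩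
  rw [Units.coe_map, MonoidHom.comp_apply, RingHom.toMonoidHom_eq_coe, MonoidHom.coe_coe, Algebra.algebraMap_eq_smul_one]
  rfl

/-- **`det` COMMUTES WITH PARALLEL TRANSPORT (9)**: `u(Γ) = det U(Γ)·1` for every lattice word `Γ` (the determinant is multiplicative). [cite: Balaban1985Averaging, (9) p.18] -/
theorem hol_det {U : B7Prop1Explicit.Site d → Fin d → (Matrix n n ℂ)ˣ} {u : B7Prop1Explicit.Site d → Fin d → (Matrix m m ℂ)ˣ}
    (hdet : ∀ x κ, (u x κ : Matrix m m ℂ) = (U x κ : Matrix n n ℂ).det • (1 : Matrix m m ℂ)) (x : B7Prop1Explicit.Site d) (w : List (Letter d)) :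
    ((hol u x w : (Matrix m m ℂ)ˣ) : Matrix m m ℂ) = ((hol U x w : (Matrix n n ℂ)ˣ) : Matrix n n ℂ).det • (1 : Matrix m m ℂ) := by
  set φ : Matrix n n ℂ →* Matrix m m ℂ := ((algebraMap ℂ (Matrix m m ℂ)).toMonoidHom).comp Matrix.detMonoidHom with hφ
  have hφapp : ∀ M : Matrix n n ℂ, φ M = M.det • (1 : Matrix m m ℂ) := fun M => by
    rw [hφ, MonoidHom.comp_apply, RingHom.toMonoidHom_eq_coe, MonoidHom.coe_coe, Algebra.algebraMap_eq_smul_one]; rfl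
  have hu : u = fun y κ => Units.map φ (U y κ) := by
    funext y κ; apply Units.ext; rw [Units.coe_map, hφapp, hdet]
  have key : ∀ (y : B7Prop1Explicit.Site d) (w : List (Letter d)), hol (fun y κ => Units.map φ (U y κ)) y w = Units.map φ (hol U y w) := by
    intro y w
    induction w generalizing y with
    | nil => simp
    | cons l w ih =>
      rw [hol_cons, hol_cons, map_mul, ih]
      congr 1
      rcases l with ⟨κ, _ | _⟩
      · rw [stepHol_false, stepHol_false, map_inv]
      · rw [stepHol_true, stepHol_true]
  rw [hu, key, Units.coe_map, hφapp]

/-- **`det` of the contour variable of (42)**: `u(Γ_{c,x})u(c)⁻¹ = det[U(Γ_{c,x})U(c)⁻¹]·1` (it is the holonomy of a closed contour). [cite: Balaban1985Averaging, (42) p.23] -/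
theorem Wcx_det {U : B7Prop1Explicit.Site d → Fin d → (Matrix n n ℂ)ˣ} {u : B7Prop1Explicit.Site d → Fin d → (Matrix m m ℂ)ˣ}
    (hdet : ∀ x κ, (u x κ : Matrix m m ℂ) = (U x κ : Matrix n n ℂ).det • (1 : Matrix m m ℂ)) (L : ℕ) (q : B7Prop1Explicit.Site d) (κ : Fin d) (r : B7Prop1Explicit.Site d) :
    ((Wcx L u q κ r : (Matrix m m ℂ)ˣ) : Matrix m m ℂ) = ((Wcx L U q κ r : (Matrix n n ℂ)ˣ) : Matrix n n ℂ).det • (1 : Matrix m m ℂ) := by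
  rw [Wcx_eq_hol_loop, Wcx_eq_hol_loop, hol_det hdet]

/-- The determinant configuration of a `U(n)`-valued configuration is `U(1)`-valued (`|det W| = 1` for unitary `W`). [folklore] -/
theorem isUnitaryCfg_det {U : B7Prop1Explicit.Site d → Fin d → (Matrix n n ℂ)ˣ} {u : B7Prop1Explicit.Site d → Fin d → (Matrix m m ℂ)ˣ}
    (hdet : ∀ x κ, (u x κ : Matrix m m ℂ) = (U x κ : Matrix n n ℂ).det • (1 : Matrix m m ℂ)) (hU : IsUnitaryCfg U) : IsUnitaryCfg u := by
  intro x κ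
  rw [mem_unitaryUnits, hdet]
  apply smul_one_mem_unitary
  have h := Unitary.star_mul_self_of_mem (mem_unitaryUnits.mp (hU x κ))
  have hd := congrArg Matrix.det h
  rw [Matrix.det_mul, Matrix.star_eq_conjTranspose, Matrix.det_conjTranspose, Matrix.det_one, Complex.star_def, Complex.conj_mul'] at hd
  have h2 : ‖(U x κ : Matrix n n ℂ).det‖ ^ 2 = 1 := by exact_mod_cast hd
  nlinarith [norm_nonneg ((U x κ : Matrix n n ℂ).det)]

/-- The determinant configuration of a `P`-periodic configuration is `P`-periodic. [folklore] -/
theorem isPeriodicCfg_det {U : B7Prop1Explicit.Site d → Fin d → (Matrix n n ℂ)ˣ} {u : B7Prop1Explicit.Site d → Fin d → (Matrix m m ℂ)ˣ}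
    (hdet : ∀ x κ, (u x κ : Matrix m m ℂ) = (U x κ : Matrix n n ℂ).det • (1 : Matrix m m ℂ)) {P : ℤ} (hP : IsPeriodicCfg U P) : IsPeriodicCfg u P := by
  intro x κ μ
  apply Units.ext
  rw [hdet, hdet, hP]

/-- **★ THE SMALL-FIELD CLASS PASSES TO THE DETERMINANT with the radius scaled by `2n`**: `SmallField U a`, `a ≤ 1∕3`, `U` unitary ⟹ `SmallField u (2·n·a)` (file A:
`|det W − 1| ≤ 2n|W − 1|` on the guard). [cite: Balaban1985Averaging, (44) p.24] -/
theorem smallField_det [Nonempty m] {U : B7Prop1Explicit.Site d → Fin d → (Matrix n n ℂ)ˣ} {u : B7Prop1Explicit.Site d → Fin d → (Matrix m m ℂ)ˣ}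
    (hdet : ∀ x κ, (u x κ : Matrix m m ℂ) = (U x κ : Matrix n n ℂ).det • (1 : Matrix m m ℂ)) (hU : IsUnitaryCfg U) {a : ℝ} (ha : a ≤ 1 / 3) (hUa : SmallField U a) :
    SmallField u (2 * Fintype.card n * a) := by
  intro x κ κ' hκ
  rw [hol_det hdet, norm_smul_one_sub_one]
  have hW : ((hol U x (plaqWord κ κ') : (Matrix n n ℂ)ˣ) : Matrix n n ℂ) ∈ Matrix.unitaryGroup n ℂ := mem_unitaryUnits.mp (hol_mem_of hU x _)
  have hs := hUa x κ κ' hκ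
  refine (norm_det_sub_one_le hW (hs.trans ha)).trans ?_
  have hc : (0 : ℝ) ≤ 2 * Fintype.card n := by positivity
  exact mul_le_mul_of_nonneg_left hs hc

/-- **The determinant configuration of the scalar configuration `e^{iG}·1_n` is `e^{i·n·G}·1`** (`det(e^{ig}·1_n) = e^{ing}`). [folklore] -/
theorem det_scalarCfg_imag (G : B7Prop1Explicit.Site d → Fin d → ℝ) (x : B7Prop1Explicit.Site d) (κ : Fin d) :
    ((scalarCfg (n := m) (fun y ν => (((Fintype.card n * G y ν : ℝ)) : ℂ) * Complex.I) x κ : (Matrix m m ℂ)ˣ) : Matrix m m ℂ)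
      = ((scalarCfg (n := n) (fun y ν => ((G y ν : ℝ) : ℂ) * Complex.I) x κ : (Matrix n n ℂ)ˣ) : Matrix n n ℂ).det • (1 : Matrix m m ℂ) := by
  simp only [scalarCfg, val_expUnit, ← cexp_smul_one]
  rw [Matrix.det_smul, Matrix.det_one, mul_one, ← Complex.exp_nat_mul]
  congr 2
  push_cast; ring

/-! ## §2 The block average (42) and its iterate (43) commute with `det` on the guard -/

section Average

variable [Nonempty n] [Nonempty m] {L : ℕ} {U : B7Prop1Explicit.Site d → Fin d → (Matrix n n ℂ)ˣ} {u : B7Prop1Explicit.Site d → Fin d → (Matrix m m ℂ)ˣ}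

/-- **`log(det W·1) = (tr log W)·1` for the contour variables of (42) on the guard** `n|W − 1| ≤ 1∕3` (`W = U(Γ_{c,x})U(c)⁻¹` unitary): `det W = e^{iτ(W)}`, `|τ| ≤ 2n|W − 1| ≤ 2∕3 < ln 2`,
so `log(e^{iτ}·1) = iτ·1 = (tr log W)·1` (file A). [cite: Balaban1985Averaging, (21) p.21, (42) p.23] -/
theorem mlog_Wcx_det (hdet : ∀ x κ, (u x κ : Matrix m m ℂ) = (U x κ : Matrix n n ℂ).det • (1 : Matrix m m ℂ)) (hU : IsUnitaryCfg U)
    (q : B7Prop1Explicit.Site d) (κ : Fin d) (r : B7Prop1Explicit.Site d) (hs : Fintype.card n * ‖((Wcx L U q κ r : (Matrix n n ℂ)ˣ) : Matrix n n ℂ) - 1‖ ≤ 1 / 3) :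
    mlog ((Wcx L u q κ r : (Matrix m m ℂ)ˣ) : Matrix m m ℂ) = (mlog ((Wcx L U q κ r : (Matrix n n ℂ)ˣ) : Matrix n n ℂ)).trace • (1 : Matrix m m ℂ) := by
  have hWu : ((Wcx L U q κ r : (Matrix n n ℂ)ˣ) : Matrix n n ℂ) ∈ Matrix.unitaryGroup n ℂ := by
    rw [Wcx_eq_hol_loop]; exact mem_unitaryUnits.mp (hol_mem_of hU q _)
  -- `n ≥ 1`, so the guard gives `‖W − 1‖ ≤ 1/3`
  have hc1 : (1 : ℝ) ≤ Fintype.card n := by exact_mod_cast Fintype.card_pos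
  have hs3 : ‖((Wcx L U q κ r : (Matrix n n ℂ)ˣ) : Matrix n n ℂ) - 1‖ ≤ 1 / 3 := by
    have h0 : 0 ≤ ‖((Wcx L U q κ r : (Matrix n n ℂ)ˣ) : Matrix n n ℂ) - 1‖ := norm_nonneg _
    nlinarith
  set τ : ℝ := (mlog ((Wcx L U q κ r : (Matrix n n ℂ)ˣ) : Matrix n n ℂ)).trace.im with hτ
  have hτle : |τ| < Real.log 2 := by
    have h := abs_tau_le (W := ((Wcx L U q κ r : (Matrix n n ℂ)ˣ) : Matrix n n ℂ)) (hs3.trans (by norm_num))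
    have hl2 : (0.6931471803 : ℝ) < Real.log 2 := Real.log_two_gt_d9
    have : 2 * (Fintype.card n : ℝ) * ‖((Wcx L U q κ r : (Matrix n n ℂ)ˣ) : Matrix n n ℂ) - 1‖ ≤ 2 / 3 := by linarith
    linarith
  rw [Wcx_det hdet, det_eq_cexp_tau hWu hs3, cexp_smul_one,
    mlog_exp_smul_one (by rw [norm_mul, Complex.norm_I, mul_one, Complex.norm_real, Real.norm_eq_abs]; exact hτle)]
  congr 1
  exact (trace_mlog_eq_tau_mul_I hWu hs3).symm

/-- **`X_c(u) = (tr X_c(U))·1`**: the exponent of (42) for the determinant configuration, on the guard at every `x ∈ B(c₋)`. [cite: Balaban1985Averaging, (42) p.23] -/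
theorem Xavg_det (hdet : ∀ x κ, (u x κ : Matrix m m ℂ) = (U x κ : Matrix n n ℂ).det • (1 : Matrix m m ℂ)) (hU : IsUnitaryCfg U)
    (q : B7Prop1Explicit.Site d) (κ : Fin d) (hs : ∀ r : Fin d → Fin L, Fintype.card n * ‖((Wcx L U q κ (boxVec L r) : (Matrix n n ℂ)ˣ) : Matrix n n ℂ) - 1‖ ≤ 1 / 3) :
    Xavg L u q κ = (Xavg L U q κ).trace • (1 : Matrix m m ℂ) := by
  unfold Xavg
  rw [Matrix.trace_sum, Finset.sum_smul]
  refine Finset.sum_congr rfl fun r _ => ?_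
  rw [mlog_Wcx_det hdet hU q κ (boxVec L r) (hs r), Matrix.trace_smul, smul_assoc]

/-- **★★ THE BLOCK AVERAGE (42) COMMUTES WITH `det`**: `ū_c = det(Ū_c)·1` on the guard (`det e^{X_c} = e^{tr X_c}` — Liouville; `det` multiplicative).
[cite: Balaban1985Averaging, (42) p.23] -/
theorem bavg_det (hdet : ∀ x κ, (u x κ : Matrix m m ℂ) = (U x κ : Matrix n n ℂ).det • (1 : Matrix m m ℂ)) (hU : IsUnitaryCfg U)
    (q : B7Prop1Explicit.Site d) (κ : Fin d) (hs : ∀ r : Fin d → Fin L, Fintype.card n * ‖((Wcx L U q κ (boxVec L r) : (Matrix n n ℂ)ˣ) : Matrix n n ℂ) - 1‖ ≤ 1 / 3) :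
    ((bavg L u q κ : (Matrix m m ℂ)ˣ) : Matrix m m ℂ) = ((bavg L U q κ : (Matrix n n ℂ)ˣ) : Matrix n n ℂ).det • (1 : Matrix m m ℂ) := by
  simp only [bavg, Units.val_mul, val_expUnit]
  rw [Xavg_det hdet hU q κ hs, hol_det hdet, Matrix.det_mul, det_exp_eq_exp_trace, ← Complex.exp_eq_exp_ℂ, ← cexp_smul_one, smul_mul_assoc, one_mul, smul_smul]

omit [Nonempty n] [Nonempty m] in
/-- Rescaling commutes with `det` (it only re-indexes bonds). [folklore] -/
theorem rescale_det (hdet : ∀ x κ, (u x κ : Matrix m m ℂ) = (U x κ : Matrix n n ℂ).det • (1 : Matrix m m ℂ)) (x : B7Prop1Explicit.Site d) (κ : Fin d) :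
    ((rescale L u x κ : (Matrix m m ℂ)ˣ) : Matrix m m ℂ) = ((rescale L U x κ : (Matrix n n ℂ)ˣ) : Matrix n n ℂ).det • (1 : Matrix m m ℂ) := by
  rw [rescale_apply, rescale_apply, hdet]

omit [Nonempty n] [Nonempty m] in
/-- **The guard from the small-field class**: `SmallField U a` with `1024·n·(d+1)(d+4)L²·a ≤ 2` (so `512(d+1)(d+4)L²a ≤ 1`) gives `n|U(Γ_{c,x})U(c)⁻¹ − 1| ≤ 1∕3` at every
`L`-bond and every `x ∈ B(c₋)` (`|…| ≤ 16(d+1)(d+4)L²a`, `B7Prop2Explicit.norm_Wcx_sub_one_le`). [cite: Balaban1985Averaging, p.25] -/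
theorem wcx_guard_of_smallField (hL : 1 ≤ L) (hU : IsUnitaryCfg U) {a : ℝ} (ha : 0 ≤ a) (hsmall : 1024 * Fintype.card n * ((d : ℝ) + 1) * (d + 4) * (L : ℝ) ^ 2 * a ≤ 2)
    (hUa : SmallField U a) (q : B7Prop1Explicit.Site d) (κ : Fin d) (r : Fin d → Fin L) :
    Fintype.card n * ‖((Wcx L U q κ (boxVec L r) : (Matrix n n ℂ)ˣ) : Matrix n n ℂ) - 1‖ ≤ 1 / 3 := by
  rcases isEmpty_or_nonempty n with hn | hn
  · simp only [Fintype.card_eq_zero, Nat.cast_zero, zero_mul]; norm_num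
  have hc1 : (1 : ℝ) ≤ Fintype.card n := by exact_mod_cast Fintype.card_pos
  have hnn : 0 ≤ ((d : ℝ) + 1) * (d + 4) * (L : ℝ) ^ 2 * a := by positivity
  have hsmall' : 512 * ((d : ℝ) + 1) * (d + 4) * (L : ℝ) ^ 2 * a ≤ 1 := by nlinarith
  have h := norm_Wcx_sub_one_le L hL U (fun x κ => mem_U1_of_unitary (hU x κ)) ha hsmall' hUa q κ r
  have hc0 : (0 : ℝ) ≤ Fintype.card n := by positivity
  calc (Fintype.card n : ℝ) * ‖((Wcx L U q κ (boxVec L r) : (Matrix n n ℂ)ˣ) : Matrix n n ℂ) - 1‖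
      ≤ Fintype.card n * (2 * (8 * (d + 1) * (d + 4) * (L : ℝ) ^ 2 * a)) := mul_le_mul_of_nonneg_left h hc0
    _ ≤ 1 / 3 := by nlinarith

/-- **★★ THE ITERATED AVERAGE (43) COMMUTES WITH `det`** in leaf-05's regime, RANK-SCALED: for `U(n)`-valued `U` in `SmallField U (ε∕(L^k)²)` with `16·C0·ε ≤ 3` and
`1024·n·(d+1)(d+4)L²·ε ≤ 1` (`L ≥ 2`), `avgIter L u j = det(avgIter L U j)·1` for all `j ≤ k` — the iterates stay unitary and `2ε`-small (`MinimalActionCompact.avgIter_unitary_smallField_two`), so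
the guard holds at every level. [cite: Balaban1985Averaging, (43) p.24] -/
theorem avgIter_det (hL : 2 ≤ L) (hdet : ∀ x κ, (u x κ : Matrix m m ℂ) = (U x κ : Matrix n n ℂ).det • (1 : Matrix m m ℂ)) (hU : IsUnitaryCfg U)
    {ε : ℝ} (hε0 : 0 ≤ ε) (hε1 : 16 * C0 d * ε ≤ 3) (hε2n : 1024 * Fintype.card n * ((d : ℝ) + 1) * (d + 4) * (L : ℝ) ^ 2 * ε ≤ 1)
    {k : ℕ} (hUε : SmallField U (ε / ((L : ℝ) ^ k) ^ 2)) :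
    ∀ {j : ℕ}, j ≤ k → ∀ x κ, ((avgIter L u j x κ : (Matrix m m ℂ)ˣ) : Matrix m m ℂ) = ((avgIter L U j x κ : (Matrix n n ℂ)ˣ) : Matrix n n ℂ).det • (1 : Matrix m m ℂ) := by
  have hL1 : 1 ≤ L := by omega
  have hc1 : (1 : ℝ) ≤ Fintype.card n := by exact_mod_cast Fintype.card_pos
  have hnn : 0 ≤ ((d : ℝ) + 1) * (d + 4) * (L : ℝ) ^ 2 * ε := by positivity
  have hε2 : 1024 * ((d : ℝ) + 1) * (d + 4) * (L : ℝ) ^ 2 * ε ≤ 1 := by nlinarith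
  intro j
  induction j with
  | zero => intro _ x κ; simpa using hdet x κ
  | succ j ih =>
    intro hj x κ
    have hj' : j ≤ k := by omega
    obtain ⟨hUj, hSj⟩ := avgIter_unitary_smallField_two hL hU hε0 hε1 hε2 hUε hj'
    have hguard := fun q κ' r => wcx_guard_of_smallField (U := avgIter L U j) hL1 hUj (by positivity) (by nlinarith) hSj q κ' r
    rw [avgIter_succ, avgIter_succ, rescale_apply, rescale_apply]
    exact bavg_det (ih hj') hUj _ _ (hguard _ _)

end Average

/-! ## §3 The (8)-class and admissibility pass to the determinant configuration -/

/-- **`U ∈ sfClass d L N ε k ⟹ u ∈ sfClass d L N (2nε) k`** (`ε ≤ 1∕3`): unitary ↦ unitary, periodic ↦ periodic, radius `ε∕(L^k)² ↦ 2nε∕(L^k)²`.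
[cite: Balaban1985Variational, (6) p.278, (8) p.279] -/
theorem sfClass_det [Nonempty m] {L N k : ℕ} (hL : 1 ≤ L) {ε : ℝ} (hε0 : 0 ≤ ε) (hε : ε ≤ 1 / 3) {U : B7Prop1Explicit.Site d → Fin d → (Matrix n n ℂ)ˣ}
    {u : B7Prop1Explicit.Site d → Fin d → (Matrix m m ℂ)ˣ} (hdet : ∀ x κ, (u x κ : Matrix m m ℂ) = (U x κ : Matrix n n ℂ).det • (1 : Matrix m m ℂ))
    (hU : U ∈ sfClass d L N ε k) : u ∈ sfClass d L N (2 * Fintype.card n * ε) k := by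
  obtain ⟨hUu, hUp, hUs⟩ := hU
  refine ⟨isUnitaryCfg_det hdet hUu, isPeriodicCfg_det hdet hUp, ?_⟩
  have hL1r : (1 : ℝ) ≤ ((L : ℝ) ^ k) ^ 2 := one_le_pow₀ (one_le_pow₀ (by exact_mod_cast hL))
  have hεk : ε / ((L : ℝ) ^ k) ^ 2 ≤ 1 / 3 := (div_le_self hε0 hL1r).trans hε
  have h := smallField_det hdet hUu hεk hUs
  rwa [← mul_div_assoc] at h

/-- **★★ ADMISSIBILITY PASSES TO THE DETERMINANT**: if `U` is admissible for the scalar datum `V = e^{iG}·1_n` of run `k` over `sfClass d L N ε` (leaf-05's regime rank-scaled: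
`16·C0·ε ≤ 3`, `1024·n·(d+1)(d+4)L²ε ≤ 1`, `L ≥ 2`), then its determinant configuration `u` is admissible for the rank-`m` scalar datum `e^{i·n·G}·1` of run `k` over
`sfClass d L N (2nε)`: `avgIter L u k = det(avgIter L U k)·1 = det(e^{iG}·1_n)·1 = e^{inG}·1`. [cite: Balaban1985Variational, (3) p.278, (8) p.279] -/
theorem admissible_det [Nonempty n] [Nonempty m] {L N k : ℕ} (hL : 2 ≤ L) {ε : ℝ} (hε0 : 0 ≤ ε) (hε1 : 16 * C0 d * ε ≤ 3)
    (hε2n : 1024 * Fintype.card n * ((d : ℝ) + 1) * (d + 4) * (L : ℝ) ^ 2 * ε ≤ 1) {G : B7Prop1Explicit.Site d → Fin d → ℝ}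
    {U : B7Prop1Explicit.Site d → Fin d → (Matrix n n ℂ)ˣ} {u : B7Prop1Explicit.Site d → Fin d → (Matrix m m ℂ)ˣ}
    (hdet : ∀ x κ, (u x κ : Matrix m m ℂ) = (U x κ : Matrix n n ℂ).det • (1 : Matrix m m ℂ))
    (hadm : U ∈ admissible (sfClass d L N ε) L k (scalarCfg (n := n) (fun y ν => ((G y ν : ℝ) : ℂ) * Complex.I))) :
    u ∈ admissible (sfClass d L N (2 * Fintype.card n * ε)) L k (scalarCfg (n := m) (fun y ν => (((Fintype.card n * G y ν : ℝ)) : ℂ) * Complex.I)) := by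
  obtain ⟨hUcl, havg⟩ := hadm
  have hL1 : 1 ≤ L := by omega
  -- `ε ≤ 1/3` from the regime (`(d+1)(d+4)L² ≥ 16`)
  have hε3 : ε ≤ 1 / 3 := by
    have hc1 : (1 : ℝ) ≤ Fintype.card n := by exact_mod_cast Fintype.card_pos
    have hd0 : (0 : ℝ) ≤ d := by positivity
    have hL2r : (2 : ℝ) ≤ L := by exact_mod_cast hL
    have h4 : (4 : ℝ) ≤ ((d : ℝ) + 1) * (d + 4) := by nlinarith
    have hL4 : (4 : ℝ) ≤ (L : ℝ) ^ 2 := by nlinarith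
    have h16 : (16 : ℝ) ≤ ((d : ℝ) + 1) * (d + 4) * (L : ℝ) ^ 2 := by
      have := mul_le_mul h4 hL4 (by norm_num) (by positivity); linarith
    have hP : (16 : ℝ) ≤ Fintype.card n * (((d : ℝ) + 1) * (d + 4) * (L : ℝ) ^ 2) := by
      have := mul_le_mul hc1 h16 (by norm_num) (by positivity); linarith
    have h1 : 16 * ε ≤ Fintype.card n * (((d : ℝ) + 1) * (d + 4) * (L : ℝ) ^ 2) * ε := mul_le_mul_of_nonneg_right hP hε0
    have h2 : 1024 * (Fintype.card n * (((d : ℝ) + 1) * (d + 4) * (L : ℝ) ^ 2) * ε) ≤ 1 := by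
      calc 1024 * (Fintype.card n * (((d : ℝ) + 1) * (d + 4) * (L : ℝ) ^ 2) * ε)
          = 1024 * Fintype.card n * ((d : ℝ) + 1) * (d + 4) * (L : ℝ) ^ 2 * ε := by ring
        _ ≤ 1 := hε2n
    linarith
  refine ⟨sfClass_det hL1 hε0 hε3 hdet hUcl, ?_⟩
  funext x κ
  apply Units.ext
  rw [avgIter_det hL hdet hUcl.1 hε0 hε1 hε2n hUcl.2.2 le_rfl x κ, havg, det_scalarCfg_imag]

end

end Summit.QuantumFields.YangMills.BalabanUVNodes.N16DetTransport
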